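import Summits.CriticalPhenomena.PercolationContinuityZ3.Theorems.PercNearOneGluingNoHeavyLowerTailAPLTwoThirdsKron
import Summits.CriticalPhenomena.PercolationContinuityZ3.Theorems.PercNearOneGluingNoHeavyLowerTailOneCutCertAssembly
import HarnessLib

/-!
# APL at the sharp constant `2/3` on every weighted graph with at most six vertices
# (`3·P(a ↔ exactly one of b,c) ≥ 2·P(b ↮ c)·P(a ↔ b ∨ a ↔ c)`), by multiplier-free two-copy certificates

builds on p205010 (kernel theorem, internal audit signed; external expert review pending)

Support file (`--supports stmt-CriticalPhenomena-4575`), seat `prim-cert-1` (gen 11); memo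
`run/shared/lean/prim/prim-cert-1/FROM-prim-cert-1-g11-FIBRE-APL.md`.  COMPUTATIONAL: the four certificate checks
`AplKron.aplCheck k 0 1 2 20 = true` (`k = 3, 4, 5, 6`; `k = 6` is `3^15` fibres of `K6`) are evaluated by `native_decide`;
everything else is standard-axiom bookkeeping (relabelling along a vertex permutation, prim-cert-2's
`OneCutCert.relabelW` / `prodBernoulli_real_preimage_relabel`).

* `AplKron.APL23 w a b c` — the property `2·P(b ↮ c)·P(a ↔ b ∨ a ↔ c) ≤ 3·P({a ↔ b} Δ {a ↔ c})` ("Φ ≥ 2/3" of the lineage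
  prim-ineq-gen-8 / prim-ineq-prove-5; `2/3` is their conjectured all-graph infimum, so the constant is sharp as a uniform statement);
* `AplKron.apl23_of_card_le_six` — **it holds at every apex `a` and targets `b, c` (pairwise distinct) of EVERY weighted graph on `Fin n`,
  `n ≤ 6`**; `AplKron.apl1_of_card_le_six` — the weaker product form `2·P(S₀)·P(S₃) ≤ 3·P(exactly one)` for any events
  `S₀ ⊆ {b ↮ c}`, `S₃ ⊆ {a ↔ b ∨ a ↔ c}` (e.g. `S₀ = {a|b|c}`, `S₃ = {abc}`: APL₁(2/3)).
HONEST LABEL: computational (`Lean.ofReduceBool` via `native_decide`), like the OneCutCert / TwoCopy / FarKron instance files; the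
all-graph statement (conjecture FIBRE-APL(2/3) of the memo) is NOT claimed.
-/

namespace Summit.CriticalPhenomena.PercolationContinuityZ3.Theorems.AplKron

open MeasureTheory
open Literature.Probability.Percolation Literature.Probability.LatticeModels
open Summit.CriticalPhenomena.PercolationContinuityZ3.Theorems.OneCutCert
open scoped Classical

variable {n : ℕ}

/-! ## The property and its transport along vertex permutations -/

/-- **APL at `2/3` (Φ-form)** at apex `a`, targets `b, c` for the weights `w`:
`2·P(b ↮ c)·P(a ↔ b ∨ a ↔ c) ≤ 3·P(a ↔ exactly one of b, c)`. [this work] -/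
def APL23 (w : Sym2 (Fin n) → unitInterval) (a b c : Fin n) : Prop :=
  2 * ((prodBernoulli w).real (openConn b c)ᶜ * (prodBernoulli w).real (openConn a b ∪ openConn a c))
    ≤ 3 * (prodBernoulli w).real (exactlyOne a b c)

/-- `{σa ↔ σb} ∪ {σa ↔ σc}` pulls back to `{a ↔ b} ∪ {a ↔ c}`. [folklore] -/
theorem preimage_relabel_union (σ : Equiv.Perm (Fin n)) (a b c : Fin n) :
    BondConfig.relabel (sym2Equiv σ) ⁻¹' (openConn (σ a) (σ b) ∪ openConn (σ a) (σ c) : Set (BondConfig (Fin n)))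
      = (openConn a b ∪ openConn a c : Set (BondConfig (Fin n))) := by
  rw [Set.preimage_union, preimage_relabel_openConn, preimage_relabel_openConn]

/-- The exactly-one event pulls back to the exactly-one event. [folklore] -/
theorem preimage_relabel_exactlyOne (σ : Equiv.Perm (Fin n)) (a b c : Fin n) :
    BondConfig.relabel (sym2Equiv σ) ⁻¹' exactlyOne (σ a) (σ b) (σ c) = exactlyOne a b c := by
  ext ω
  have hb := Set.ext_iff.1 (preimage_relabel_openConn σ a b) ω
  have hc := Set.ext_iff.1 (preimage_relabel_openConn σ a c) ω
  simp only [Set.mem_preimage] at hb hc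
  simp only [exactlyOne, Set.mem_preimage, Set.mem_setOf_eq, hb, hc]

/-- **Relabelling**: `APL23` for `(w, a, b, c)` follows from `APL23` for `(w^σ, σa, σb, σc)`. [this work] -/
theorem APL23.of_relabel (σ : Equiv.Perm (Fin n)) (w : Sym2 (Fin n) → unitInterval) (a b c : Fin n)
    (h : APL23 (relabelW σ w) (σ a) (σ b) (σ c)) : APL23 w a b c := by
  unfold APL23 at h ⊢
  rw [real_compl_openConn_relabel σ w b c,
    ← prodBernoulli_real_preimage_relabel (sym2Equiv σ) w (relabelW σ w) (relabelW_apply σ w)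
      (openConn (σ a) (σ b) ∪ openConn (σ a) (σ c) : Set (BondConfig (Fin n))),
    preimage_relabel_union,
    ← prodBernoulli_real_preimage_relabel (sym2Equiv σ) w (relabelW σ w) (relabelW_apply σ w)
      (exactlyOne (σ a) (σ b) (σ c)),
    preimage_relabel_exactlyOne] at h
  exact h

/-- Three pairwise distinct points can be moved to three prescribed pairwise distinct points by a permutation
(three transpositions). [folklore] -/
theorem exists_perm_three {α : Type*} [DecidableEq α] (a b c t₀ t₁ t₂ : α) (hab : a ≠ b) (hac : a ≠ c)
    (hbc : b ≠ c) (h01 : t₀ ≠ t₁) (h02 : t₀ ≠ t₂) (h12 : t₁ ≠ t₂) :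
    ∃ σ : Equiv.Perm α, σ a = t₀ ∧ σ b = t₁ ∧ σ c = t₂ := by
  let σ₁ : Equiv.Perm α := Equiv.swap a t₀
  have h1a : σ₁ a = t₀ := Equiv.swap_apply_left a t₀
  have h1b : σ₁ b ≠ t₀ := fun h => hab (σ₁.injective (h1a.trans h.symm))
  have h1c : σ₁ c ≠ t₀ := fun h => hac (σ₁.injective (h1a.trans h.symm))
  have h1bc : σ₁ b ≠ σ₁ c := fun h => hbc (σ₁.injective h)
  let σ₂ : Equiv.Perm α := Equiv.swap (σ₁ b) t₁
  have h2b : σ₂ (σ₁ b) = t₁ := Equiv.swap_apply_left _ _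
  have h2a : σ₂ t₀ = t₀ := Equiv.swap_apply_of_ne_of_ne h1b.symm h01
  have h2c : σ₂ (σ₁ c) ≠ t₀ := fun h => h1c (σ₂.injective (h.trans h2a.symm))
  have h2c1 : σ₂ (σ₁ c) ≠ t₁ := fun h => h1bc.symm (σ₂.injective (h.trans h2b.symm))
  let σ₃ : Equiv.Perm α := Equiv.swap (σ₂ (σ₁ c)) t₂
  have h3c : σ₃ (σ₂ (σ₁ c)) = t₂ := Equiv.swap_apply_left _ _
  have h30 : σ₃ t₀ = t₀ := Equiv.swap_apply_of_ne_of_ne h2c.symm h02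
  have h31 : σ₃ t₁ = t₁ := Equiv.swap_apply_of_ne_of_ne h2c1.symm h12
  refine ⟨(σ₁.trans σ₂).trans σ₃, ?_, ?_, ?_⟩
  · rw [Equiv.trans_apply, Equiv.trans_apply, h1a, h2a, h30]
  · rw [Equiv.trans_apply, Equiv.trans_apply, h2b, h31]
  · rw [Equiv.trans_apply, Equiv.trans_apply, h3c]

/-! ## The certificate checks (COMPUTATIONAL) -/

/-- The `K3` check (3 coordinates). [this work] -/
theorem apl3_check : aplCheck 3 0 1 2 20 = true := by native_decide

/-- The `K4` check (6 coordinates). [this work] -/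
theorem apl4_check : aplCheck 4 0 1 2 20 = true := by native_decide

/-- The `K5` check (10 coordinates, `3^10` fibres). [this work] -/
theorem apl5_check : aplCheck 5 0 1 2 20 = true := by native_decide

/-- The `K6` check (15 coordinates, `3^15 = 14 348 907` fibres; kit cross-check: aplfib.c, min fibre sum 0). [this work] -/
theorem apl6_check : aplCheck 6 0 1 2 20 = true := by native_decide

/-! ## Assembly -/

/-- `APL23` on `Fin 3`. [this work] -/
theorem apl23_fin3 (w : Sym2 (Fin 3) → unitInterval) (a b c : Fin 3) (hab : a ≠ b) (hac : a ≠ c) (hbc : b ≠ c) :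
    APL23 w a b c := by
  obtain ⟨σ, ha, hb, hc⟩ := exists_perm_three a b c (0 : Fin 3) 1 2 hab hac hbc (by decide) (by decide) (by decide)
  refine APL23.of_relabel σ w a b c ?_
  rw [ha, hb, hc]
  exact aplCheck_sound 0 1 2 20 apl3_check (relabelW σ w)

/-- `APL23` on `Fin 4`. [this work] -/
theorem apl23_fin4 (w : Sym2 (Fin 4) → unitInterval) (a b c : Fin 4) (hab : a ≠ b) (hac : a ≠ c) (hbc : b ≠ c) :
    APL23 w a b c := by
  obtain ⟨σ, ha, hb, hc⟩ := exists_perm_three a b c (0 : Fin 4) 1 2 hab hac hbc (by decide) (by decide) (by decide)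
  refine APL23.of_relabel σ w a b c ?_
  rw [ha, hb, hc]
  exact aplCheck_sound 0 1 2 20 apl4_check (relabelW σ w)

/-- `APL23` on `Fin 5`. [this work] -/
theorem apl23_fin5 (w : Sym2 (Fin 5) → unitInterval) (a b c : Fin 5) (hab : a ≠ b) (hac : a ≠ c) (hbc : b ≠ c) :
    APL23 w a b c := by
  obtain ⟨σ, ha, hb, hc⟩ := exists_perm_three a b c (0 : Fin 5) 1 2 hab hac hbc (by decide) (by decide) (by decide)
  refine APL23.of_relabel σ w a b c ?_
  rw [ha, hb, hc]
  exact aplCheck_sound 0 1 2 20 apl5_check (relabelW σ w)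

/-- `APL23` on `Fin 6`. [this work] -/
theorem apl23_fin6 (w : Sym2 (Fin 6) → unitInterval) (a b c : Fin 6) (hab : a ≠ b) (hac : a ≠ c) (hbc : b ≠ c) :
    APL23 w a b c := by
  obtain ⟨σ, ha, hb, hc⟩ := exists_perm_three a b c (0 : Fin 6) 1 2 hab hac hbc (by decide) (by decide) (by decide)
  refine APL23.of_relabel σ w a b c ?_
  rw [ha, hb, hc]
  exact aplCheck_sound 0 1 2 20 apl6_check (relabelW σ w)

/-- Three pairwise distinct elements of `Fin n` force `3 ≤ n`. [folklore] -/
theorem three_le_of_distinct (a b c : Fin n) (hab : a ≠ b) (hac : a ≠ c) (hbc : b ≠ c) : 3 ≤ n := by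
  have hcard : ({a, b, c} : Finset (Fin n)).card = 3 := by
    rw [Finset.card_insert_of_notMem (by simp [hab, hac]), Finset.card_insert_of_notMem (by simp [hbc]),
      Finset.card_singleton]
  have h := Finset.card_le_univ ({a, b, c} : Finset (Fin n))
  rw [hcard, Fintype.card_fin] at h
  exact h

/-- **APL at `2/3` on at most six vertices.**  For every `n ≤ 6`, every weight vector `w` on `Fin n` and all pairwise distinct
`a, b, c`: `2·P(b ↮ c)·P(a ↔ b ∨ a ↔ c) ≤ 3·P(a ↔ exactly one of b, c)`.  COMPUTATIONAL (four `native_decide` certificate checks). [this work] -/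
theorem apl23_of_card_le_six (hn : n ≤ 6) (w : Sym2 (Fin n) → unitInterval) (a b c : Fin n) (hab : a ≠ b) (hac : a ≠ c)
    (hbc : b ≠ c) : APL23 w a b c := by
  have h3 := three_le_of_distinct a b c hab hac hbc
  rcases (show n = 3 ∨ n = 4 ∨ n = 5 ∨ n = 6 by omega) with h | h | h | h <;> subst h
  · exact apl23_fin3 w a b c hab hac hbc
  · exact apl23_fin4 w a b c hab hac hbc
  · exact apl23_fin5 w a b c hab hac hbc
  · exact apl23_fin6 w a b c hab hac hbc

/-- **Product form (APL₁-type) on at most six vertices.**  For `n ≤ 6`, pairwise distinct `a, b, c`, and ANY events `S₀ ⊆ {b ↮ c}`,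
`S₃ ⊆ {a ↔ b ∨ a ↔ c}` (e.g. `S₀ = {a, b, c pairwise separated}`, `S₃ = {a, b, c all joined}`): `2·P(S₀)·P(S₃) ≤ 3·P(a ↔ exactly one of b, c)`,
i.e. the lineage's APL₁ at the constant `2/3`. [this work] -/
theorem apl1_of_card_le_six (hn : n ≤ 6) (w : Sym2 (Fin n) → unitInterval) (a b c : Fin n) (hab : a ≠ b) (hac : a ≠ c)
    (hbc : b ≠ c) (S₀ S₃ : Set (BondConfig (Fin n))) (h₀ : S₀ ⊆ (openConn b c)ᶜ)
    (h₃ : S₃ ⊆ (openConn a b ∪ openConn a c : Set (BondConfig (Fin n)))) :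
    2 * ((prodBernoulli w).real S₀ * (prodBernoulli w).real S₃) ≤ 3 * (prodBernoulli w).real (exactlyOne a b c) := by
  have h := apl23_of_card_le_six hn w a b c hab hac hbc
  unfold APL23 at h
  have h0 : (prodBernoulli w).real S₀ ≤ (prodBernoulli w).real (openConn b c)ᶜ := measureReal_mono h₀
  have h3' : (prodBernoulli w).real S₃ ≤ (prodBernoulli w).real (openConn a b ∪ openConn a c : Set (BondConfig (Fin n))) :=
    measureReal_mono h₃
  have hp : 0 ≤ (prodBernoulli w).real S₀ := measureReal_nonneg
  have hq : 0 ≤ (prodBernoulli w).real (openConn a b ∪ openConn a c : Set (BondConfig (Fin n))) := measureReal_nonneg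
  nlinarith [mul_le_mul h0 h3' measureReal_nonneg (le_trans hp h0)]

end Summit.CriticalPhenomena.PercolationContinuityZ3.Theorems.AplKron
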